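import Summits.BirchSwinnertonDyer.BirchSwinnertonDyer.Theorems.PrintX11aUpperNonSurjFiveExcShallowSector
import HarnessLib

/-!
# Crux U5 `PrintX11a.UpperNonSurjFive` (item stmt-BirchSwinnertonDyer-20614), line «gl1cartan5», EXCEPTIONAL-ZERO road:
# ★ the exceptional-zero Tamagawa divisibility CLASS-FREE — «`E/ℚ`, `p ≥ 5` SPLIT multiplicative, `E[p]` irreducible and FINITE at `p` (`p ∣ ord_p Δ_min`)
# ⟹ `p ∣ L(E,1)/Ω_E` whenever `L(E,1) ≠ 0`», modulo the six named facts — no class, no (ram)/(no-ram), no surjectivity hypothesis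

Cell `bsd-print-x11a`, seat `cruxlead-stmt-BirchSwinnertonDyer-20614` (LEAD g6); `--supports stmt-BirchSwinnertonDyer-20614 --as helper`, closes nothing. File 12 of the
EXCEPTIONAL-ZERO road. `…ExcShallowSector.one_le_padicValRat_LOne_div_of_classX11a_split` (p686445) proves the divisibility on class X11a, where EVERY multiplicative
prime `ℓ ≠ p` is unramified for `E[p]` and the removed set of the level-lowering fact is «all multiplicative primes». THIS FILE removes the class: the removed set is
`R = D·p` with `D` the squarefree product of the multiplicative primes `ℓ ≠ p` at which `E[p]` IS unramified (`p ∣ ord_ℓ Δ_min`), the kept multiplicative primes are then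
ramified by construction, and the fact `ribet1990_levelLowering_gamma0_newform_general_of_five_le` (p685873) applies verbatim; `…ExcDivisibility` does the rest. The
finiteness of `E[p]` at `p` (`p ∣ ord_p Δ_min`, Darmon–Diamond–Taylor Prop. 2.12 (d)) is a HYPOTHESIS here (on X11a it follows from non-surjectivity,
`ClassX11a.dvd_padicValInt_self_of_not_surj`); without it there is nothing to lower and BSD predicts no divisibility (`p ∤ c_p`). Theorems only; no definition, no named fact,
no `sorry`; BSD is not proved by any of this; the statement is the BSD-predicted consequence of `p ∣ c_p = ord_p Δ_min` and `p ∤ #E(ℚ)_tors`.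

* §1 `exists_unramifiedMultDecomposition` — `N_E = M₀·D·p`, `D` = the squarefree product of the multiplicative `ℓ ≠ p` with `p ∣ ord_ℓ Δ_min` (arithmetic).
* §2 ★ `one_le_padicValRat_LOne_div_of_split_of_finite` — the class-free divisibility, CONDITIONAL on `hCE hGV hI hMz hnf hLL`.

## References

* H. Darmon, F. Diamond, R. Taylor (1995), Thm. 3.15, Prop. 2.12 [DarmonDiamondTaylor1995]; K. A. Ribet (1990), Thm. 1.1 [Ribet1990]; V. Vatsal (1999) §1 [Vatsal1999];
  R. Greenberg, V. Vatsal (2000) §3 [GreenbergVatsal2000]; K. A. Ribet, ICM 1983, Thm. 4.1 [Ribet1984ICM]; R. F. Coleman, B. Edixhoven (1998), Thm. 2.1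
  [ColemanEdixhoven1998]; B. Mazur (1978), Cor. 4.1 [Mazur1978]; J. H. Silverman, ATAEC (1994), Thm. IV.10.2 [SilvermanATAEC1994].
-/

set_option autoImplicit false
-- the Theorems namespace of a single-conjunct summit repeats the summit name by design (D-0017)
set_option linter.dupNamespace false

noncomputable section

open scoped MatrixGroups ModularForm Classical NNReal

open CongruenceSubgroup WeierstrassCurve IsDedekindDomain Literature.NumberTheory.EllipticCurves
  Literature.NumberTheory.EllipticCurves.ModularForms
  Literature.NumberTheory.EllipticCurves.Rank1Residual
  Summit.BirchSwinnertonDyer.Rank1Residual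

namespace Summit.BirchSwinnertonDyer.BirchSwinnertonDyer.Theorems.GL1Cartan.Exc

/-! ### §1 The decomposition `N = M₀·D·p` along the UNRAMIFIED multiplicative primes -/

section Arith

/-- **`N_E = M₀·D·p` with `D` the (squarefree) product of the multiplicative primes `ℓ ≠ p` at which `E[p]` is unramified (`p ∣ ord_ℓ Δ_min`)**, for `E`
multiplicative at `p`: `p ∤ M₀D`, `D` prime to `M₀`, every prime of `D` is such a prime, and every such prime divides `D` (`ℓ` multiplicative iff `ℓ ∥ N_E`:
Silverman ATAEC IV.10.2). [cite: SilvermanATAEC1994, Thm. IV.10.2 (a)–(c)] -/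
theorem exists_unramifiedMultDecomposition (W : WeierstrassCurve ℚ) [W.IsElliptic] [W.IsGloballyMinimal] (p : ℕ) [Fact p.Prime]
    (hmult : W.HasMultiplicativeReductionAtPrime p) :
    ∃ M₀ D : ℕ, M₀ ≠ 0 ∧ M₀ * D * p = W.conductorNorm ℤ ∧ ¬ p ∣ M₀ * D ∧ Squarefree D ∧ Nat.Coprime D M₀ ∧
      (∀ (r : ℕ) (hr : r.Prime), r ∣ D → r ≠ p ∧ (haveI : Fact r.Prime := ⟨hr⟩; W.HasMultiplicativeReductionAtPrime r) ∧
        p ∣ padicValInt r W.minimalDiscriminantInt) ∧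
      (∀ (q : ℕ) (hq : q.Prime), (haveI : Fact q.Prime := ⟨hq⟩; W.HasMultiplicativeReductionAtPrime q) → q ≠ p →
        p ∣ padicValInt q W.minimalDiscriminantInt → q ∣ D) := by
  classical
  have hp : p.Prime := Fact.out
  set N : ℕ := W.conductorNorm ℤ with hNdef
  have hN : N ≠ 0 := (W.conductorNorm_pos_holds).ne'
  have hpN : p ∣ N := X9.PrintCert.dvd_conductorNorm_of_not_hasGoodReductionAtPrime W
    (Rank1Residual.not_hasGoodReductionAtPrime_of_hasMultiplicativeReductionAtPrime p hmult)
  have hp2 : ¬ p ^ 2 ∣ N :=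
    Theorems.not_sq_dvd_conductorNorm_of_hasMultiplicativeReductionAtPrime W p hmult
  set S : Finset ℕ := N.primeFactors.filter (fun ℓ => ℓ ≠ p ∧ ¬ ℓ ^ 2 ∣ N ∧ p ∣ padicValInt ℓ W.minimalDiscriminantInt) with hS
  set D : ℕ := ∏ ℓ ∈ S, ℓ with hD
  have hSmem : ∀ ℓ, ℓ ∈ S ↔ ℓ.Prime ∧ ℓ ∣ N ∧ ℓ ≠ p ∧ ¬ ℓ ^ 2 ∣ N ∧ p ∣ padicValInt ℓ W.minimalDiscriminantInt := by
    intro ℓ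
    rw [hS, Finset.mem_filter, Nat.mem_primeFactors]
    tauto
  have hSprime : ∀ ℓ ∈ S, ℓ.Prime := fun ℓ h => ((hSmem ℓ).mp h).1
  have hdvdD : ∀ r : ℕ, r.Prime → r ∣ D → r ∈ S := by
    intro r hr hrD
    obtain ⟨ℓ, hℓS, hrℓ⟩ := (Prime.dvd_finsetProd_iff hr.prime (fun ℓ : ℕ => ℓ)).mp hrD
    have : r = ℓ := (Nat.prime_dvd_prime_iff_eq hr (hSprime ℓ hℓS)).mp hrℓ
    subst this; exact hℓS
  have hDp : D * p ∣ N := by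
    have h1 : (∏ ℓ ∈ insert p S, ℓ) ∣ N := by
      refine Finset.prod_primes_dvd N (fun ℓ hℓ => ?_) (fun ℓ hℓ => ?_)
      · rcases Finset.mem_insert.mp hℓ with rfl | h
        · exact hp.prime
        · exact (hSprime ℓ h).prime
      · rcases Finset.mem_insert.mp hℓ with rfl | h
        · exact hpN
        · exact ((hSmem ℓ).mp h).2.1
    have hpS : p ∉ S := fun h => ((hSmem p).mp h).2.2.1 rfl
    rw [Finset.prod_insert hpS] at h1
    rwa [mul_comm] at h1
  set M₀ := N / (D * p) with hM₀
  have hMDp : M₀ * (D * p) = N := Nat.div_mul_cancel hDp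
  have hM₀0 : M₀ ≠ 0 := by
    intro h0; rw [h0, zero_mul] at hMDp; exact hN hMDp.symm
  have hpD : ¬ p ∣ D := fun h => ((hSmem p).mp (hdvdD p hp h)).2.2.1 rfl
  have hpM₀ : ¬ p ∣ M₀ := by
    rintro ⟨k, hk⟩
    apply hp2
    refine ⟨k * D, ?_⟩
    rw [← hMDp, hk]; ring
  have hcop : Nat.Coprime D M₀ := by
    refine Nat.Coprime.prod_left fun ℓ hℓ => (Nat.Prime.coprime_iff_not_dvd (hSprime ℓ hℓ)).mpr ?_
    rintro ⟨k, hk⟩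
    apply ((hSmem ℓ).mp hℓ).2.2.2.1
    have hℓD : ℓ ∣ D := Finset.dvd_prod_of_mem _ hℓ
    obtain ⟨d, hd⟩ := hℓD
    refine ⟨k * d * p, ?_⟩
    rw [← hMDp, hk, hd]; ring
  have hsq : Squarefree D := by
    rw [Nat.squarefree_iff_prime_squarefree]
    intro q hq hqq
    have hqD : q ∣ D := dvd_trans (dvd_mul_right q q) hqq
    have hqS : q ∈ S := hdvdD q hq hqD
    have hsplit : D = q * ∏ ℓ ∈ S.erase q, ℓ := by
      rw [hD, ← Finset.mul_prod_erase S (fun ℓ : ℕ => ℓ) hqS]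
    rw [hsplit] at hqq
    have hq' : q ∣ ∏ ℓ ∈ S.erase q, ℓ := by
      obtain ⟨k, hk⟩ := hqq
      refine ⟨k, ?_⟩
      apply Nat.eq_of_mul_eq_mul_left hq.pos
      rw [hk]; ring
    obtain ⟨ℓ, hℓ, hqℓ⟩ := (Prime.dvd_finsetProd_iff hq.prime (fun ℓ : ℕ => ℓ)).mp hq'
    have hℓS : ℓ ∈ S := Finset.mem_of_mem_erase hℓ
    have : q = ℓ := (Nat.prime_dvd_prime_iff_eq hq (hSprime ℓ hℓS)).mp hqℓ
    subst this
    exact Finset.ne_of_mem_erase hℓ rfl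
  refine ⟨M₀, D, hM₀0, by rw [mul_assoc]; exact hMDp, ?_, hsq, hcop, fun r hr hrD => ?_, fun q hq hqm hqp hqΔ => ?_⟩
  · intro h
    rcases (Nat.Prime.dvd_mul hp).mp h with h | h
    · exact hpM₀ h
    · exact hpD h
  · have h := (hSmem r).mp (hdvdD r hr hrD)
    haveI : Fact r.Prime := ⟨hr⟩
    refine ⟨h.2.2.1, ?_, h.2.2.2.2⟩
    rcases hasGoodReductionAtPrime_or_hasMultiplicativeReductionAtPrime_of_not_sq_dvd_conductorNorm (V := W) h.2.2.2.1 with hg | hm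
    · exact absurd h.2.1 (not_dvd_conductorNorm_of_hasGoodReductionAtPrime W hg)
    · exact hm
  · haveI : Fact q.Prime := ⟨hq⟩
    have hqN : q ∣ N := X9.PrintCert.dvd_conductorNorm_of_not_hasGoodReductionAtPrime W
      (Rank1Residual.not_hasGoodReductionAtPrime_of_hasMultiplicativeReductionAtPrime q hqm)
    have hq2 : ¬ q ^ 2 ∣ N :=
      Theorems.not_sq_dvd_conductorNorm_of_hasMultiplicativeReductionAtPrime W q hqm
    exact Finset.dvd_prod_of_mem (fun ℓ : ℕ => ℓ) ((hSmem q).mpr ⟨hq, hqN, hqp, hq2, hqΔ⟩)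

end Arith

/-! ### §2 ★ The class-free exceptional-zero Tamagawa divisibility -/

section Divisibility

variable {W : WeierstrassCurve ℚ} [W.IsElliptic] [W.IsGloballyMinimal] {p : ℕ} [Fact p.Prime]

/-- ★ **THE EXCEPTIONAL-ZERO TAMAGAWA DIVISIBILITY, class-free (CONDITIONAL on six named facts).** Let `E/ℚ` (globally minimal `W`) have SPLIT multiplicative
reduction at a prime `p ≥ 5`, with `E[p]` irreducible and FINITE at `p` (`p ∣ ord_p Δ_min`). If `L(E,1)/Ω_E = t ∈ ℚ` with `t ≠ 0`, then **`1 ≤ ord_p t`** — `p` divides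
`L(E,1)/Ω_E`, as BSD predicts from `p ∣ c_p`. Facts BY NAME: `hCE` (Coleman–Edixhoven 1998 Thm. 2.1), `hGV` (Greenberg–Vatsal 2000 §3 (17)–(19)), `hI` (Ribet 1984
Thm. 4.1, Ihara), `hMz` (Mazur 1978 Cor. 4.1), `hnf` (modularity), `hLL` (`ribet1990_levelLowering_gamma0_newform_general_of_five_le`, Darmon–Diamond–Taylor Thm. 3.15
at `p ≥ 5`). Road: §1's decomposition; the removed set `R = D·p` consists of unramified (`ℓ ∣ D`) resp. finite (`p`) multiplicative primes and every kept multiplicative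
prime is ramified, so `hLL` supplies the level-`M₀` newform; `…ExcDivisibility.one_le_padicValRat_LOne_div_realPeriod_of_exists_levelLoweredNewform` concludes.
[cite: DarmonDiamondTaylor1995, Thm. 3.15 and Prop. 2.12 (d)] [cite: GreenbergVatsal2000, §3 (17)–(19), Remark 3.4] [cite: Vatsal1999, §1 (1.6), Thm. (1.13)]
[cite: Ribet1984ICM, Thm. 4.1] [cite: ColemanEdixhoven1998, Thm. 2.1] [cite: Mazur1978, Cor. 4.1] -/
theorem one_le_padicValRat_LOne_div_of_split_of_finite
    (hCE : colemanEdixhoven1998_heckePolynomial_simpleRoots)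
    (hGV : greenbergVatsal2000_plusSymbol_congruence) (hI : ribet1984_iharaLemma)
    (hMz : mazur_not_dvd_maninConstant_of_odd) (hnf : exists_isNewformOf) (hLL : ribet1990_levelLowering_gamma0_newform_general_of_five_le)
    (hp5 : 5 ≤ p) (hsplit : W.HasSplitMultiplicativeReductionAtPrime p) (hirr : W.HasIrreducibleModPGaloisRep p)
    (hfin : p ∣ padicValInt p W.minimalDiscriminantInt) :
    ∀ t : ℚ, W.entireLFunction 1 / (W.realPeriodRat : ℂ) = (t : ℂ) → t ≠ 0 → 1 ≤ padicValRat p t := by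
  intro t ht ht0
  have hp : p.Prime := Fact.out
  haveI : NeZero (W.conductorNorm ℤ) := ⟨(W.conductorNorm_pos_holds).ne'⟩
  obtain ⟨f, hf⟩ := hnf W
  have hmult : W.HasMultiplicativeReductionAtPrime p := hsplit.hasMultiplicativeReductionAtPrime
  obtain ⟨M₀, D, hM₀0, hMD, hpMD, hDsq, hDM₀, hDprimes, hmultD⟩ := exists_unramifiedMultDecomposition W p hmult
  haveI : NeZero M₀ := ⟨hM₀0⟩
  have hpD : ¬ p ∣ D := fun h => hpMD (h.mul_left M₀)
  have hpM₀ : ¬ p ∣ M₀ := fun h => hpMD (h.mul_right D)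
  have hMR : M₀ * (D * p) = W.conductorNorm ℤ := by rw [← mul_assoc]; exact hMD
  have hRsq : Squarefree (D * p) :=
    (Nat.squarefree_mul ((Nat.Prime.coprime_iff_not_dvd hp).mpr hpD).symm).mpr ⟨hDsq, hp.prime.squarefree⟩
  have hRcop : Nat.Coprime (D * p) M₀ := Nat.Coprime.mul_left hDM₀ ((Nat.Prime.coprime_iff_not_dvd hp).mpr hpM₀)
  have hp2N : ¬ p ^ 2 ∣ W.conductorNorm ℤ := Theorems.not_sq_dvd_conductorNorm_of_hasMultiplicativeReductionAtPrime W p hmult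
  have hR : ∀ (r : ℕ) (hr : r.Prime), r ∣ D * p →
      (haveI : Fact r.Prime := ⟨hr⟩; W.HasMultiplicativeReductionAtPrime r) ∧ p ∣ padicValInt r W.minimalDiscriminantInt := by
    intro r hr hrDp
    by_cases hrp : r = p
    · subst hrp
      exact ⟨hmult, hfin⟩
    · have hrD : r ∣ D := by
        rcases (Nat.Prime.dvd_mul hr).mp hrDp with h | h
        · exact h
        · exact absurd ((Nat.prime_dvd_prime_iff_eq hr hp).mp h) hrp
      obtain ⟨-, hmr, hur⟩ := hDprimes r hr hrD
      exact ⟨hmr, hur⟩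
  have hK : ∀ (q : ℕ) (hq : q.Prime), (haveI : Fact q.Prime := ⟨hq⟩; W.HasMultiplicativeReductionAtPrime q) → ¬ q ∣ D * p →
      ¬ p ∣ padicValInt q W.minimalDiscriminantInt := by
    intro q hq hqm hqR hqΔ
    by_cases hqp : q = p
    · subst hqp; exact hqR (dvd_mul_left q D)
    · exact hqR ((hmultD q hq hqm hqp hqΔ).mul_right p)
  have hex : ∀ ι : PadicAlgCl p ≃+* ℂ, ∃ g : CuspForm (Gamma0 M₀) 2, IsNewform0 g ∧
      (∀ ℓ : ℕ, ℓ.Prime → ¬ ℓ ∣ D * p → Valued.v (ι.symm (cuspCoeff f ℓ - cuspCoeff g ℓ)) < 1) ∧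
      (∀ ℓ : ℕ, ℓ.Prime → ℓ ∣ D * p → Valued.v (ι.symm (cuspCoeff g ℓ - cuspCoeff f ℓ * (ℓ + 1))) < 1) :=
    fun ι => hLL W p hp5 hirr hMR hRsq hRcop hp2N rfl hR hK f hf ι
  have hsign : ∀ ℓ : ℕ, ℓ.Prime → ℓ ∣ D → ∃ u : ℤ, u * u = 1 ∧ cuspCoeff f ℓ = u := by
    intro ℓ hℓ hℓD
    haveI : Fact ℓ.Prime := ⟨hℓ⟩
    obtain ⟨-, hmℓ, -⟩ := hDprimes ℓ hℓ hℓD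
    refine ⟨W.LFunction ℓ, ?_, hf.2 ℓ⟩
    have hsq := (LFunction_prime_pow_of_hasMultiplicativeReductionAtPrime W ℓ hmℓ 0).2
    rw [pow_two] at hsq
    exact hsq
  exact one_le_padicValRat_LOne_div_realPeriod_of_exists_levelLoweredNewform hCE hGV hI hMz W hp5 hsplit hirr rfl hf hMD hpMD
    hDsq hDM₀ hsign hex t ht ht0

end Divisibility

end Summit.BirchSwinnertonDyer.BirchSwinnertonDyer.Theorems.GL1Cartan.Exc

end
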